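import Mathlib
import Summits.KontsevichZagierPeriods.Zeta5Search.Elimination.PencilDescent
import HarnessLib

/-!
# Wedge dictionary — the boundary STRATA of the dictionary-side STAR / PENCIL nodes (gen-1 g19)

HONEST FRAMING: systematic search; no irrationality claim unless certified.  Identities among the dictionary vectors
`(Q, P̂, P)` only; nothing about integrals, sizes or ζ(5).

OUR work (Summit side; cell `pub-zeta5`, lineage gen-1).  gen-1's global dictionary nodes `DictStar` / `DictPencil`
(`WedgeDictionaryThreeTerm`) are proved POINTWISE in the interior by the elimination lineage
(`Elimination.dictStar_at`: all slots `≥ 1`, moving slots `≥ 2` and `≤ P₀ − 2`, the other non-edge pairs `≤ P₀`;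
`Elimination.dictPencil_at`: `1 ≤ c_i ≤ c₀ − 1`, non-edge pairs avoiding `i` `≤ c₀`).  gen-1 g19's instance census of the
terminal-template certificates (`HOME/pub-zeta5-gen-1/D2-DICTCENSUS-g19.md`: 2292 relation instances, 1072 covered by the
interior theorems, 1220 residual) shows that what the certificates consume beyond the interior is exactly three STAR strata
and three PENCIL strata.  This file NAMES those strata as statements of the same shape as the global nodes and proves the two
partition theorems

* `dictStar_of_strata   : DictStarZeroStrata → DictStarTopFace → DictStarLow → DictStar`,
* `dictPencil_of_strata : DictPencilPosTopFace → Elimination.DictPencilZero → DictPencilLevelOneTop → DictPencil`,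

the interior being discharged by `dictStar_at` / `dictPencil_at`; with the converse restrictions of Sect. 2 each global node
is EQUIVALENT to the conjunction of its strata.  So the by-name targets whose conjunction IS the global node are:
`DictStarZeroStrata` (a zero non-moving apex slot or a moving slot equal to `1`; symbolic), `DictStarTopFace` (a saturated
non-moving non-edge pair `P_j + P_l = P₀ + 1`; symbolic), `DictStarLow` (apex level `≤ 3`; finitely many instances),
`DictPencilPosTopFace` (positive slot, saturated non-edge pair avoiding `i`), `Elimination.DictPencilZero` (tree node) and
`DictPencilLevelOneTop` (level-1 base with `c_i = 1`; finitely many instances).  Nothing here is conjectural: the strata are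
`def`s tagged `conjecture` like the nodes they refine, and every theorem is pure case analysis on gen-1's `RegionHyp` boxes
`0 ≤ 2b_m ≤ b₀ + 1`.
-/

noncomputable section

open Finset

namespace Summit.KontsevichZagierPeriods.Zeta5Search.WedgeDictionary

open Literature.NumberTheory.Irrationality.BrownZudilin2022 (bOfA)
open Summit.KontsevichZagierPeriods.Zeta5Search.Elimination (DictPencilZero dictStar_at dictPencil_at)

/-! ## 1. The strata as named statements -/

/-- **STAR, dictionary side, on the ZERO STRATA (INTERNALLY MINTED; conjecture).**  gen-1's `DictStar` relation at an apex
`P = b(a)` one of whose moving slots equals `1` (the leg `P − s_i` lands on a zero slot) or one of whose slots is `0`, away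
from the top faces (legs `≤ P₀ − 2`, the other non-edge pairs `≤ P₀`).  997 + 905 of the 1094 residual STAR instances of the
terminal-template certificates lie here (gen-1 g19 census). -/
@[conjecture] def DictStarZeroStrata : Prop :=
  ∀ (a : Fin 8 → ℤ) (i k j₀ j₁ j₂ : ℕ), i ∈ Icc 1 7 → k ∈ Icc 1 7 → i ≠ k →
    (bOfA a i = 1 ∨ bOfA a k = 1 ∨ ∃ m ∈ Icc 1 7, bOfA a m = 0) →
    bOfA a i + 2 ≤ bOfA a 0 → bOfA a k + 2 ≤ bOfA a 0 →
    (∀ jk ∈ nonEpairs, ¬(jk.1 = i ∧ jk.2 = k) → ¬(jk.1 = k ∧ jk.2 = i) → bOfA a jk.1 + bOfA a jk.2 ≤ bOfA a 0) →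
    RegionHyp a j₀ → RegionHyp (a + slotDown k) j₁ → RegionHyp (a + slotDown i) j₂ →
      DictThreeTerm (starKappa (bOfA a) i k) (-fanCoeff (bOfA a) k) (fanCoeff (bOfA a) i)
        a (a + slotDown k) (a + slotDown i) j₀ j₁ j₂

/-- **STAR, dictionary side, on a TOP FACE (INTERNALLY MINTED; conjecture).**  gen-1's `DictStar` relation at an apex with a
saturated non-moving non-edge pair `P_j + P_l = P₀ + 1` (`{j,l} ≠ {i,k}`), legs `≤ P₀ − 2`.  48 residual instances of the
certificates (the `TopPair`/`TopSixMax` families and levels 3, 5). -/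
@[conjecture] def DictStarTopFace : Prop :=
  ∀ (a : Fin 8 → ℤ) (i k j₀ j₁ j₂ : ℕ) (jl : ℕ × ℕ), i ∈ Icc 1 7 → k ∈ Icc 1 7 → i ≠ k →
    jl ∈ nonEpairs → ¬(jl.1 = i ∧ jl.2 = k) → ¬(jl.1 = k ∧ jl.2 = i) → bOfA a jl.1 + bOfA a jl.2 = bOfA a 0 + 1 →
    bOfA a i + 2 ≤ bOfA a 0 → bOfA a k + 2 ≤ bOfA a 0 →
    RegionHyp a j₀ → RegionHyp (a + slotDown k) j₁ → RegionHyp (a + slotDown i) j₂ →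
      DictThreeTerm (starKappa (bOfA a) i k) (-fanCoeff (bOfA a) k) (fanCoeff (bOfA a) i)
        a (a + slotDown k) (a + slotDown i) j₀ j₁ j₂

/-- **STAR, dictionary side, at LOW LEVEL `P₀ ≤ 3` (INTERNALLY MINTED; conjecture; FINITELY MANY instances).**  The only place a
leg can be near the top (`P_i = P₀ − 1` forces `P₀ ≤ 3` by the box `2P_i ≤ P₀ + 1`); 356 concrete residual instances of the
certificates have apex level `≤ 3`. -/
@[conjecture] def DictStarLow : Prop :=
  ∀ (a : Fin 8 → ℤ) (i k j₀ j₁ j₂ : ℕ), i ∈ Icc 1 7 → k ∈ Icc 1 7 → i ≠ k → bOfA a 0 ≤ 3 →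
    RegionHyp a j₀ → RegionHyp (a + slotDown k) j₁ → RegionHyp (a + slotDown i) j₂ →
      DictThreeTerm (starKappa (bOfA a) i k) (-fanCoeff (bOfA a) k) (fanCoeff (bOfA a) i)
        a (a + slotDown k) (a + slotDown i) j₀ j₁ j₂

/-- **PENCIL, dictionary side, positive slot on a TOP FACE (INTERNALLY MINTED; conjecture).**  gen-1's `DictPencil` relation at a
base `c = b(a)` with `1 ≤ c_i ≤ c₀ − 1` and a saturated non-edge pair `c_j + c_l = c₀ + 1` avoiding `i` (the case
`Elimination.dictPencil_at` excludes); NOT consumed by the terminal-template certificates (0 instances), listed for completeness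
of the partition. -/
@[conjecture] def DictPencilPosTopFace : Prop :=
  ∀ (a : Fin 8 → ℤ) (i j₀ j₁ j₂ : ℕ) (jl : ℕ × ℕ), i ∈ Icc 1 7 → 1 ≤ bOfA a i → bOfA a i + 1 ≤ bOfA a 0 →
    jl ∈ nonEpairs → jl.1 ≠ i → jl.2 ≠ i → bOfA a jl.1 + bOfA a jl.2 = bOfA a 0 + 1 →
    RegionHyp a j₀ → RegionHyp (a + dsUp) j₁ → RegionHyp (a + dsUp + slotDown i) j₂ →
      DictThreeTerm (pencilBase (bOfA a)) (pencilApex (bOfA a) i) (fanCoeff (bOfA (a + dsUp)) i)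
        a (a + dsUp) (a + dsUp + slotDown i) j₀ j₁ j₂

/-- **PENCIL, dictionary side, at the LEVEL-1 TOPS (INTERNALLY MINTED; conjecture; FINITELY MANY instances).**  gen-1's
`DictPencil` relation at a level-1 base with `c_i = 1` (the twin of cert-1's `DictPencilLevelOne`, which has `c_i = 0`);
14 distinct (base, slot) pairs, 31 instances in the certificates. -/
@[conjecture] def DictPencilLevelOneTop : Prop :=
  ∀ (a : Fin 8 → ℤ) (i j₀ j₁ j₂ : ℕ), i ∈ Icc 1 7 → bOfA a 0 = 1 → bOfA a i = 1 →
    RegionHyp a j₀ → RegionHyp (a + dsUp) j₁ → RegionHyp (a + dsUp + slotDown i) j₂ →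
      DictThreeTerm (pencilBase (bOfA a)) (pencilApex (bOfA a) i) (fanCoeff (bOfA (a + dsUp)) i)
        a (a + dsUp) (a + dsUp + slotDown i) j₀ j₁ j₂

/-! ## 2. Shape sanity: each stratum is a restriction of the global node -/

/-- `DictStar` restricts to the zero strata. -/
theorem dictStarZeroStrata_of_dictStar (h : DictStar) : DictStarZeroStrata :=
  fun a i k j₀ j₁ j₂ hi hk hik _ _ _ _ H₀ H₁ H₂ => h a i k j₀ j₁ j₂ hi hk hik H₀ H₁ H₂

/-- `DictStar` restricts to the top faces. -/
theorem dictStarTopFace_of_dictStar (h : DictStar) : DictStarTopFace :=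
  fun a i k j₀ j₁ j₂ _ hi hk hik _ _ _ _ _ _ H₀ H₁ H₂ => h a i k j₀ j₁ j₂ hi hk hik H₀ H₁ H₂

/-- `DictStar` restricts to low level. -/
theorem dictStarLow_of_dictStar (h : DictStar) : DictStarLow :=
  fun a i k j₀ j₁ j₂ hi hk hik _ H₀ H₁ H₂ => h a i k j₀ j₁ j₂ hi hk hik H₀ H₁ H₂

/-- `DictPencil` restricts to the positive top faces. -/
theorem dictPencilPosTopFace_of_dictPencil (h : DictPencil) : DictPencilPosTopFace :=
  fun a i j₀ j₁ j₂ _ hi _ _ _ _ _ _ H₀ H₁ H₂ => h a i j₀ j₁ j₂ hi H₀ H₁ H₂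

/-- `DictPencil` restricts to the level-1 tops. -/
theorem dictPencilLevelOneTop_of_dictPencil (h : DictPencil) : DictPencilLevelOneTop :=
  fun a i j₀ j₁ j₂ hi _ _ H₀ H₁ H₂ => h a i j₀ j₁ j₂ hi H₀ H₁ H₂

/-! ## 3. Box arithmetic from `RegionHyp` -/

/-- The six non-edge pairs have both entries in `1..7`. -/
theorem nonEpairs_mem_Icc : ∀ jk ∈ nonEpairs, jk.1 ∈ Icc 1 7 ∧ jk.2 ∈ Icc 1 7 := by decide

/-- Box bounds at a region point: `0 ≤ b_m` and `2 b_m ≤ b₀ + 1` for every slot, and `1 ≤ b₀`. -/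
theorem region_boxes {a : Fin 8 → ℤ} {j : ℕ} (H : RegionHyp a j) :
    (∀ m ∈ Icc 1 7, 0 ≤ bOfA a m ∧ 2 * bOfA a m ≤ bOfA a 0 + 1) ∧ 1 ≤ bOfA a 0 := by
  obtain ⟨hj, -, hreg, -, hpart⟩ := H
  exact ⟨hreg, by have := (hreg j hj).1; omega⟩

/-- If `a − s_i` is a region point then the slot `i` of `b(a)` is at least `1`. -/
theorem one_le_slot_of_region_slotDown {a : Fin 8 → ℤ} {i j : ℕ} (hi : i ∈ Icc 1 7)
    (H : RegionHyp (a + slotDown i) j) : 1 ≤ bOfA a i := by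
  have h := ((region_boxes H).1 i hi).1
  rw [bOfA_add_slotDown a i hi i (mem_Icc.1 hi).2, if_pos rfl] at h
  omega

/-! ## 4. The partition theorems -/

/-- **STAR partition**: the three strata and the interior theorem `Elimination.dictStar_at` exhaust `DictStar`. -/
theorem dictStar_of_strata (h1 : DictStarZeroStrata) (h2 : DictStarTopFace) (h3 : DictStarLow) : DictStar := by
  intro a i k j₀ j₁ j₂ hi hk hik H₀ H₁ H₂
  obtain ⟨hreg, h0⟩ := region_boxes H₀
  have hi1 := one_le_slot_of_region_slotDown hi H₂
  have hk1 := one_le_slot_of_region_slotDown hk H₁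
  have hbi := hreg i hi
  have hbk := hreg k hk
  by_cases hlow : bOfA a 0 ≤ 3
  · exact h3 a i k j₀ j₁ j₂ hi hk hik hlow H₀ H₁ H₂
  have hi0 : bOfA a i + 2 ≤ bOfA a 0 := by omega
  have hk0 : bOfA a k + 2 ≤ bOfA a 0 := by omega
  by_cases hsat : ∃ jl ∈ nonEpairs, ¬(jl.1 = i ∧ jl.2 = k) ∧ ¬(jl.1 = k ∧ jl.2 = i) ∧
      bOfA a jl.1 + bOfA a jl.2 = bOfA a 0 + 1
  · obtain ⟨jl, hjl, hA, hB, hC⟩ := hsat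
    exact h2 a i k j₀ j₁ j₂ jl hi hk hik hjl hA hB hC hi0 hk0 H₀ H₁ H₂
  have hNE : ∀ jk ∈ nonEpairs, ¬(jk.1 = i ∧ jk.2 = k) → ¬(jk.1 = k ∧ jk.2 = i) →
      bOfA a jk.1 + bOfA a jk.2 ≤ bOfA a 0 := by
    intro jk hjk hA hB
    obtain ⟨hj1, hj2⟩ := nonEpairs_mem_Icc jk hjk
    have b1 := hreg jk.1 hj1
    have b2 := hreg jk.2 hj2
    by_contra hC
    exact hsat ⟨jk, hjk, hA, hB, by omega⟩
  by_cases hz : bOfA a i = 1 ∨ bOfA a k = 1 ∨ ∃ m ∈ Icc 1 7, bOfA a m = 0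
  · exact h1 a i k j₀ j₁ j₂ hi hk hik hz hi0 hk0 hNE H₀ H₁ H₂
  have hP1 : ∀ m ∈ Icc 1 7, 1 ≤ bOfA a m := by
    intro m hm
    have := (hreg m hm).1
    by_contra hc
    exact hz (Or.inr (Or.inr ⟨m, hm, by omega⟩))
  have hi2 : 2 ≤ bOfA a i := by
    by_contra hc
    exact hz (Or.inl (by omega))
  have hk2 : 2 ≤ bOfA a k := by
    by_contra hc
    exact hz (Or.inr (Or.inl (by omega)))
  exact dictStar_at a i k j₀ j₁ j₂ hi hk H₀ H₁ H₂ hP1 hi2 hk2 hi0 hk0 hNE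

/-- **PENCIL partition**: the positive top faces, the zero-slot node `Elimination.DictPencilZero`, the level-1 tops and the
interior theorem `Elimination.dictPencil_at` exhaust `DictPencil`. -/
theorem dictPencil_of_strata (h4 : DictPencilPosTopFace) (hz : DictPencilZero) (h5 : DictPencilLevelOneTop) :
    DictPencil := by
  intro a i j₀ j₁ j₂ hi H₀ H₁ H₂
  obtain ⟨hreg, h0⟩ := region_boxes H₀
  have hbi := hreg i hi
  by_cases hzero : bOfA a i = 0
  · exact hz a i j₀ j₁ j₂ hi hzero H₀ H₁ H₂
  by_cases htop : bOfA a i + 1 ≤ bOfA a 0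
  swap
  · have h01 : bOfA a 0 = 1 := by omega
    have hi1 : bOfA a i = 1 := by omega
    exact h5 a i j₀ j₁ j₂ hi h01 hi1 H₀ H₁ H₂
  have hi1 : 1 ≤ bOfA a i := by omega
  by_cases hsat : ∃ jl ∈ nonEpairs, jl.1 ≠ i ∧ jl.2 ≠ i ∧ bOfA a jl.1 + bOfA a jl.2 = bOfA a 0 + 1
  · obtain ⟨jl, hjl, hA, hB, hC⟩ := hsat
    exact h4 a i j₀ j₁ j₂ jl hi hi1 htop hjl hA hB hC H₀ H₁ H₂
  have hNE : ∀ jk ∈ nonEpairs, jk.1 ≠ i → jk.2 ≠ i → bOfA a jk.1 + bOfA a jk.2 ≤ bOfA a 0 := by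
    intro jk hjk hA hB
    obtain ⟨hj1, hj2⟩ := nonEpairs_mem_Icc jk hjk
    have b1 := hreg jk.1 hj1
    have b2 := hreg jk.2 hj2
    by_contra hC
    exact hsat ⟨jk, hjk, hA, hB, by omega⟩
  exact dictPencil_at a i j₀ j₁ j₂ hi H₀ H₁ H₂ hi1 htop hNE

end Summit.KontsevichZagierPeriods.Zeta5Search.WedgeDictionary

end
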